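import Summits.Ventures.CertifiedManyBodySolver.Observables.CrutchODLROThermodynamicLimit
import HarnessLib

/-!
# Pair ODLRO of BCS-crutch ground states: the limit at a continuity point of the order parameter

Cell `hubbard-cq` (venture `CertifiedManyBodySolver`; card `bcs-crutch-odlro-floor`, corollary column; sequel of
`CrutchODLROThermodynamicLimit.lean`). Notation as there: `H_{g,L}(h₀) = A_L(h₀) − (g/L²)Δ_dᴴΔ_d`,
`pairLRO L ψ = Re⟨ψ, Δ_dᴴΔ_d ψ⟩/L⁴`, `e = dWaveSourceEnergyDensityTT' t' U μ`, Moreau functional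
`F_g(h) = e(h) + (h − h₀)²/g` with minimisers `h⋆(g)`, order parameter `Φ(g) = |h⋆(g) − h₀|/g`.

* **`crutch_pairLRO_eventually_abs_sub_lt`** — if `Φsq` is squeezed by the Moreau data around `g` (for every
  `ε > 0` some `0 < g₁ < g < g₂` and minimisers `h₁` of `F_{g₁}`, `h₂` of `F_{g₂}` have
  `Φsq − ε ≤ (h₁ − h₀)²/(g·g₁)` and `(h₂ − h₀)²/(g·g₂) ≤ Φsq + ε`), then for every `δ > 0`, eventually in `L`,
  EVERY unit ground-state vector `ψ` of `H_{g,L}(h₀)` has `|pairLRO L ψ − Φsq| < δ`;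
* `crutchTorusTT'_pairLRO_eventually_abs_sub_lt` — the same on `crutchTorusTT'` (`h₀ = 0`) by name.

READING: the squeeze hypothesis holds with `Φsq = Φ(g)²` exactly at the continuity points of the monotone
function `g ↦ (h⋆(g) − h₀)²` (`moreau_minimiser_sq_mono`), i.e. for all but countably many couplings; there the
pair ODLRO density of the crutch ground states converges, uniformly over the ground space, to the squared
self-consistent order parameter — `ODLRO = |gap/g|²`, BCS mean-field exactness for the crutch as a limit
statement. HONEST SCOPE / WHAT THIS IS NOT: crutch Hamiltonian, not the Hubbard model; nothing at `g = 0`; grand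
canonical at one `μ`; the squeeze is a HYPOTHESIS on the TL curve `e` (not decided here for any specific `g`);
no number, no phase sentence. PROVED (two `filter_upwards` lines over the two-sided bounds); 0 definitions,
0 named facts, zero compute.

References: R. B. Griffiths, J. Math. Phys. 5 (1964) 1215, §2; J.-B. Bru, W. de Siqueira Pedra, Mem. AMS 224
(2013), §2.6; J.-J. Moreau, Bull. SMF 93 (1965) 273, §7.
-/

noncomputable section

namespace Summit.Ventures.CertifiedManyBodySolver.Observables.SourcedTorusAHM

open Matrix Finset Filter Topology Set Literature.MathematicalPhysics.QuantumLattice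
open Literature.Probability.LatticeModels
open scoped ComplexOrder

section Collapse

/-- **COLLAPSE at a continuity point** (the `Φ(g−0)² = Φ(g+0)²` case made explicit): if a number `Φsq` is
squeezed by the Moreau data at `g` — for every `ε > 0` there are couplings `0 < g₁ < g < g₂` and minimisers
`h₁` of `e + (· − h₀)²/g₁`, `h₂` of `e + (· − h₀)²/g₂` with `Φsq − ε ≤ (h₁ − h₀)²/(g·g₁)` and
`(h₂ − h₀)²/(g·g₂) ≤ Φsq + ε` (true, with `Φsq = Φ(g)² = ((h⋆(g) − h₀)/g)²`, at every continuity point of the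
monotone `(h⋆(·) − h₀)²`, i.e. for all but countably many `g`) — then the pair ODLRO density of the crutch ground
states CONVERGES to `Φsq`, uniformly over the ground space: for every `δ > 0`, eventually in `L`, every unit
ground-state vector `ψ` of `H_{g,L}(h₀)` has `|pairLRO L ψ − Φsq| < δ`. Griffiths (1964) §2; Bru–de Siqueira
Pedra (2013) §2.6. -/
theorem crutch_pairLRO_eventually_abs_sub_lt (tp U μ : ℝ) {h₀ g Φsq : ℝ} (hh₀ : 0 ≤ h₀) (hg : 0 < g)
    (hsq : ∀ ε : ℝ, 0 < ε → ∃ g₁ g₂ h₁ h₂ : ℝ, 0 < g₁ ∧ g₁ < g ∧ g < g₂ ∧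
      (∀ h : ℝ, dWaveSourceEnergyDensityTT' tp U μ h₁ + (h₁ - h₀) ^ 2 / g₁ ≤
        dWaveSourceEnergyDensityTT' tp U μ h + (h - h₀) ^ 2 / g₁) ∧
      (∀ h : ℝ, dWaveSourceEnergyDensityTT' tp U μ h₂ + (h₂ - h₀) ^ 2 / g₂ ≤
        dWaveSourceEnergyDensityTT' tp U μ h + (h - h₀) ^ 2 / g₂) ∧
      Φsq - ε ≤ (h₁ - h₀) ^ 2 / (g * g₁) ∧ (h₂ - h₀) ^ 2 / (g * g₂) ≤ Φsq + ε)
    {δ : ℝ} (hδ : 0 < δ) :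
    ∀ᶠ n : ℕ in atTop, ∀ ψ : Fock (Orb (FermionTorus 2 (n + 1))), star ψ ⬝ᵥ ψ = 1 →
      ψ ∈ (dWaveSourceTorusTT' (n + 1) tp U μ h₀ - ((g / (((n + 1 : ℕ) : ℝ)) ^ 2 : ℝ) : ℂ) •
          ((pairField dWaveFormFactor (n + 1))ᴴ * pairField dWaveFormFactor (n + 1))).groundSpace →
        |pairLRO (n + 1) ψ - Φsq| < δ := by
  obtain ⟨g₁, g₂, h₁, h₂, hg₁, hg₁g, hgg₂, hmin₁, hmin₂, hlo, hhi⟩ := hsq (δ / 4) (by positivity)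
  have hδ4 : 0 < δ / 4 := by positivity
  filter_upwards [crutch_pairLRO_eventually_ge tp U μ hh₀ hg₁ hg₁g hδ4 hmin₁,
    crutch_pairLRO_eventually_le tp U μ hh₀ hg hgg₂ hδ4 hmin₂] with n hge hle ψ hψ hGS
  have h1 := hge ψ hψ hGS
  have h2 := hle ψ hψ hGS
  rw [abs_lt]
  constructor <;> linarith

/-- The collapse by name on `crutchTorusTT'` (`h₀ = 0`): under the same squeeze of `Φsq` by the Moreau data of
`e + (·)²/g'` around `g`, eventually every unit ground-state vector of `crutchTorusTT' L t' U μ g` has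
`|pairLRO L ψ − Φsq| < δ`. -/
theorem crutchTorusTT'_pairLRO_eventually_abs_sub_lt (tp U μ : ℝ) {g Φsq : ℝ} (hg : 0 < g)
    (hsq : ∀ ε : ℝ, 0 < ε → ∃ g₁ g₂ h₁ h₂ : ℝ, 0 < g₁ ∧ g₁ < g ∧ g < g₂ ∧
      (∀ h : ℝ, dWaveSourceEnergyDensityTT' tp U μ h₁ + h₁ ^ 2 / g₁ ≤
        dWaveSourceEnergyDensityTT' tp U μ h + h ^ 2 / g₁) ∧
      (∀ h : ℝ, dWaveSourceEnergyDensityTT' tp U μ h₂ + h₂ ^ 2 / g₂ ≤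
        dWaveSourceEnergyDensityTT' tp U μ h + h ^ 2 / g₂) ∧
      Φsq - ε ≤ h₁ ^ 2 / (g * g₁) ∧ h₂ ^ 2 / (g * g₂) ≤ Φsq + ε)
    {δ : ℝ} (hδ : 0 < δ) :
    ∀ᶠ n : ℕ in atTop, ∀ ψ : Fock (Orb (FermionTorus 2 (n + 1))), star ψ ⬝ᵥ ψ = 1 →
      ψ ∈ (crutchTorusTT' (n + 1) tp U μ g).groundSpace → |pairLRO (n + 1) ψ - Φsq| < δ := by
  have hsq' : ∀ ε : ℝ, 0 < ε → ∃ g₁ g₂ h₁ h₂ : ℝ, 0 < g₁ ∧ g₁ < g ∧ g < g₂ ∧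
      (∀ h : ℝ, dWaveSourceEnergyDensityTT' tp U μ h₁ + (h₁ - 0) ^ 2 / g₁ ≤
        dWaveSourceEnergyDensityTT' tp U μ h + (h - 0) ^ 2 / g₁) ∧
      (∀ h : ℝ, dWaveSourceEnergyDensityTT' tp U μ h₂ + (h₂ - 0) ^ 2 / g₂ ≤
        dWaveSourceEnergyDensityTT' tp U μ h + (h - 0) ^ 2 / g₂) ∧
      Φsq - ε ≤ (h₁ - 0) ^ 2 / (g * g₁) ∧ (h₂ - 0) ^ 2 / (g * g₂) ≤ Φsq + ε := by
    intro ε hε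
    obtain ⟨g₁, g₂, h₁, h₂, hg₁, hg₁g, hgg₂, hmin₁, hmin₂, hlo, hhi⟩ := hsq ε hε
    exact ⟨g₁, g₂, h₁, h₂, hg₁, hg₁g, hgg₂, fun h => by simpa using hmin₁ h,
      fun h => by simpa using hmin₂ h, by simpa using hlo, by simpa using hhi⟩
  have h := crutch_pairLRO_eventually_abs_sub_lt tp U μ (h₀ := 0) le_rfl hg hsq' hδ
  filter_upwards [h] with n hn ψ hψ hGS
  rw [crutchTorusTT'_eq_model] at hGS
  exact hn ψ hψ (by simpa using hGS)

end Collapse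

end Summit.Ventures.CertifiedManyBodySolver.Observables.SourcedTorusAHM

end
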